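import Mathlib
import Summits.KontsevichZagierPeriods.Zeta5Search.BlockRatioBinomial
import Summits.KontsevichZagierPeriods.Zeta5Search.AperyFrobeniusFactorisation

/-!
# BlockRatioModSq — the block ratio one digit deeper:
`C(Np+b, Mp+d) ≡ C(N,M)·C(b,d)·(1 + p(N·H_b − M·H_d − (N−M)·H_{b−d})) (mod p²·C(N,M)C(b,d))` (cell zeta5-irr)

HONEST FRAMING: systematic search; no irrationality claim unless certified. INSTRUMENT lemma of the ζ(5)
census cell zeta5-irr (HOME `run/shared/lean/pub/zeta5-irr/`; zi-p2's THEOREM 7 blueprint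
`zi-p2/probes/B8/thm7-plan/PLAN-T7.md` L7.4 (iii): «each block ratio C(Np+b,Mp+d)/C(N,M) (main cells, 0 ≤ d ≤ b < p)
… ≡ C(b,d)·(1 + p(NH_b − MH_d − (N−M)H_{b−d})) (mod p²)»). Nothing here is about ζ(5); no irrationality content;
filing moves no rung. Filed by the engine seat zi-eng (g7); sequel of `BlockRatioBinomial` (the exact identity and
the `mod p` unit parts).

## The statement

Write `N = M + e`, `b = d + f` with `d + f < p`, `p ≥ 5` prime. From the exact identity
`C(Np+b, Mp+d)·W_M W_e ∏_{t≤d}(Mp+t) ∏_{t≤f}(ep+t) = C(N,M)·W_N ∏_{t≤b}(Np+t)` (`BlockRatioBinomial.choose_block_mul_eq`)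
and the two next-digit facts
* `∏_{t=1}^{y}(Xp + t) = y!·(1 + Xp·H_y + p²E)` with `E ∈ ℤ_(p)` for `y < p` (`prod_eq_factorial_mul`),
* `W_N ≡ W_M·W_e (mod p³)` (every block `≡ (p−1)! (mod p³)`, Glaisher; tree
  `FrobeniusFactorisation.prod_filter_mul_add_modEq` at `j = 0`: `W_X ≡ ((p−1)!)^X`),
one gets, with `C := C(N,M)·C(b,d)` and `α := N·H_b − M·H_d − e·H_f`:

**`v_p( C(Np+b, Mp+d) − C·(1 + p·α) ) ≥ v_p(C) + 2`** (`padicValuation_choose_block_sub_le`, stated as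
`Rat.padicValuation p (…) ≤ exp(−2) · Rat.padicValuation p C`), i.e. `C(Np+b,Mp+d) = C·ρ` with
`ρ ≡ 1 + p(N·H_b − M·H_d − (N−M)·H_{b−d}) (mod p²)`.
-/

namespace Summit.KontsevichZagierPeriods.Zeta5Search.BlockRatioModSq

open Finset Nat WithZero
open Summit.KontsevichZagierPeriods.Zeta5Search.OffDigitBinomials (blockW blockW_ne_zero coprime_blockW)
open Summit.KontsevichZagierPeriods.Zeta5Search.BlockRatioBinomial (choose_block_mul_eq)
open Summit.KontsevichZagierPeriods.Zeta5Search.FrobeniusFactorisation (prod_filter_mul_add_modEq)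

variable {p : ℕ} [Fact p.Prime]

/-! ## `p`-integrality bookkeeping in `ℤ_(p) = {x : v_p(x) ≥ 0} ⊂ ℚ` (the valuation ring of `Rat.padicValuation p`) -/

/-- An integer prime to `p` has valuation `1`. [folklore] -/
private theorem padicValuation_natCast_eq_one {t : ℕ} (ht : ¬ p ∣ t) : Rat.padicValuation p (t : ℚ) = 1 := by
  rw [← Int.cast_natCast, Rat.padicValuation_cast, Int.padicValuation_eq_one_iff, Int.natCast_dvd_natCast]
  exact ht

/-- `1/t ∈ ℤ_(p)` for `0 < t < p`. [folklore] -/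
private theorem inv_natCast_mem {t : ℕ} (ht0 : 0 < t) (htp : t < p) :
    ((t : ℚ))⁻¹ ∈ (Rat.padicValuation p).integer := by
  rw [Valuation.mem_integer_iff, map_inv₀, padicValuation_natCast_eq_one (fun h => ?_), inv_one]
  exact absurd (Nat.le_of_dvd ht0 h) (by omega)

/-- An integer is in `ℤ_(p)`. [folklore] -/
private theorem intCast_mem (z : ℤ) : (z : ℚ) ∈ (Rat.padicValuation p).integer := by
  rw [Valuation.mem_integer_iff, Rat.padicValuation_cast]; exact Int.padicValuation_le_one p z

/-- `H_y ∈ ℤ_(p)` for `y < p`. [folklore] -/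
private theorem harmonic_mem {y : ℕ} (hy : y < p) : harmonic y ∈ (Rat.padicValuation p).integer := by
  induction y with
  | zero => rw [harmonic_zero]; exact zero_mem _
  | succ y ih => rw [harmonic_succ]; exact add_mem (ih (by omega)) (inv_natCast_mem (by omega) hy)

/-- **The partial block one digit deeper**: for `y < p` and every `X`,
`∏_{t=1}^{y}(Xp + t) = y!·(1 + X·p·H_y + p²·E)` with `E ∈ ℤ_(p)`. -/
theorem prod_eq_factorial_mul (X : ℕ) {y : ℕ} (hy : y < p) :
    ∃ E ∈ (Rat.padicValuation p).integer,
      ((∏ t ∈ Icc 1 y, (X * p + t) : ℕ) : ℚ) = (y ! : ℚ) * (1 + (X : ℚ) * p * harmonic y + (p : ℚ) ^ 2 * E) := by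
  induction y with
  | zero => exact ⟨0, zero_mem _, by simp⟩
  | succ y ih =>
    obtain ⟨E, hE, h⟩ := ih (by omega)
    refine ⟨E + (X : ℚ) ^ 2 * harmonic y * (((y + 1 : ℕ)) : ℚ)⁻¹ + (X : ℚ) * p * E * (((y + 1 : ℕ)) : ℚ)⁻¹, ?_, ?_⟩
    · exact add_mem (add_mem hE (mul_mem (mul_mem (pow_mem (natCast_mem _ X) 2) (harmonic_mem (by omega)))
        (inv_natCast_mem (by omega) hy))) (mul_mem (mul_mem (mul_mem (natCast_mem _ X) (natCast_mem _ p)) hE)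
        (inv_natCast_mem (by omega) hy))
    · have hy0 : (((y + 1 : ℕ)) : ℚ) ≠ 0 := by positivity
      rw [Finset.prod_Icc_succ_top (by omega), Nat.cast_mul, h, Nat.factorial_succ, harmonic_succ]
      push_cast
      field_simp
      ring

/-- **`W_{M+e} ≡ W_M·W_e (mod p³)`** for a prime `p ≥ 5` (each `W_X ≡ ((p−1)!)^X`, Glaisher's block law). -/
theorem exists_blockW_add_eq (h3 : 3 < p) (M e : ℕ) :
    ∃ s : ℤ, ((blockW p (M + e) : ℕ) : ℤ) = (blockW p M : ℕ) * (blockW p e : ℕ) + (p : ℤ) ^ 3 * s := by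
  have hp : p.Prime := Fact.out
  have hW : ∀ m : ℕ, ((blockW p m : ℕ) : ℤ) ≡ (((p - 1)! : ℕ) : ℤ) ^ m [ZMOD (p : ℤ) ^ 3] := fun m => by
    have h := prod_filter_mul_add_modEq hp h3 m 0
    simp only [zero_mul, zero_add] at h
    unfold blockW
    push_cast
    exact h
  have h : ((blockW p (M + e) : ℕ) : ℤ) ≡ (blockW p M : ℕ) * (blockW p e : ℕ) [ZMOD (p : ℤ) ^ 3] :=
    (hW (M + e)).trans (by rw [pow_add]; exact ((hW M).mul (hW e)).symm)
  obtain ⟨s, hs⟩ := h.symm.dvd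
  exact ⟨s, by linear_combination hs⟩

/-- **The block ratio modulo `p²`** (PLAN-T7 L7.4 (iii)): for a prime `p ≥ 5`, `d + f < p`, all `M e`, with
`C := C(M+e, M)·C(d+f, d)` and `α := (M+e)·H_{d+f} − M·H_d − e·H_f`:
`v_p(C((M+e)p + (d+f), Mp + d) − C·(1 + p·α)) ≥ v_p(C) + 2`. -/
theorem padicValuation_choose_block_sub_le (h3 : 3 < p) (M e : ℕ) {d f : ℕ} (hdf : d + f < p) :
    Rat.padicValuation p
        (((((M + e) * p + (d + f)).choose (M * p + d) : ℕ) : ℚ) -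
          (((M + e).choose M : ℕ) : ℚ) * (((d + f).choose d : ℕ) : ℚ) *
            (1 + (p : ℚ) * (((M + e : ℕ) : ℚ) * harmonic (d + f) - (M : ℚ) * harmonic d - (e : ℚ) * harmonic f))) ≤
      exp (-2) * Rat.padicValuation p ((((M + e).choose M : ℕ) : ℚ) * (((d + f).choose d : ℕ) : ℚ)) := by
  have hp : p.Prime := Fact.out
  -- the exact identity, cast to `ℚ`
  have key := congrArg (fun x : ℕ => (x : ℚ)) (choose_block_mul_eq hp.pos M e d f)
  simp only [Nat.cast_mul] at key
  -- the next-digit expansions of the three partial blocks and of the `W`-ratio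
  obtain ⟨Eb, hEb, hPb⟩ := prod_eq_factorial_mul (p := p) (M + e) hdf
  obtain ⟨Ed, hEd, hPd⟩ := prod_eq_factorial_mul (p := p) M (show d < p by omega)
  obtain ⟨Ef, hEf, hPf⟩ := prod_eq_factorial_mul (p := p) e (show f < p by omega)
  obtain ⟨s, hs⟩ := exists_blockW_add_eq (p := p) h3 M e
  have hsQ : ((blockW p (M + e) : ℕ) : ℚ) = (blockW p M : ℕ) * (blockW p e : ℕ) + (p : ℚ) ^ 3 * (s : ℚ) := by
    exact_mod_cast hs
  have hb := congrArg (fun x : ℕ => (x : ℚ)) (Nat.choose_mul_factorial_mul_factorial (Nat.le_add_right d f))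
  rw [Nat.add_sub_cancel_left] at hb
  simp only [Nat.cast_mul] at hb
  rw [hPb, hPd, hPf, hsQ] at key
  -- names for the atoms
  set Cbig : ℚ := ((((M + e) * p + (d + f)).choose (M * p + d) : ℕ) : ℚ) with hCbig
  set Cnm : ℚ := (((M + e).choose M : ℕ) : ℚ) with hCnm
  set Cbd : ℚ := (((d + f).choose d : ℕ) : ℚ) with hCbd
  set WM : ℚ := ((blockW p M : ℕ) : ℚ) with hWM
  set We : ℚ := ((blockW p e : ℕ) : ℚ) with hWe
  set Hb : ℚ := harmonic (d + f) with hHb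
  set Hd : ℚ := harmonic d with hHd
  set Hf : ℚ := harmonic f with hHf
  -- the second-order remainder, an element of `ℤ_(p)`
  set a : ℚ := ((M + e : ℕ) : ℚ) * Hb with ha
  set c : ℚ := (M : ℚ) * Hd with hc
  set g : ℚ := (e : ℚ) * Hf with hg
  set G : ℚ := WM * We * (Eb - (Ed + Ef + c * g) - (p : ℚ) * (c * Ef + g * Ed) - (p : ℚ) ^ 2 * Ed * Ef -
      (a - c - g) * ((c + g) + (p : ℚ) * (Ed + Ef + c * g) + (p : ℚ) ^ 2 * (c * Ef + g * Ed) + (p : ℚ) ^ 3 * Ed * Ef)) +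
      (p : ℚ) * (s : ℚ) * (1 + ((M + e : ℕ) : ℚ) * p * Hb + (p : ℚ) ^ 2 * Eb) with hGdef
  have hG' : (WM * We + (p : ℚ) ^ 3 * s) * (1 + ((M + e : ℕ) : ℚ) * p * Hb + (p : ℚ) ^ 2 * Eb) -
      (1 + (p : ℚ) * (a - c - g)) * (1 + (M : ℚ) * p * Hd + (p : ℚ) ^ 2 * Ed) * (1 + (e : ℚ) * p * Hf + (p : ℚ) ^ 2 * Ef) *
        (WM * We) = (p : ℚ) ^ 2 * G := by
    rw [hGdef, ha, hc, hg]; ring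
  have hGmem : G ∈ (Rat.padicValuation p).integer := by
    have hO : ∀ n : ℕ, ((n : ℕ) : ℚ) ∈ (Rat.padicValuation p).integer := fun n => natCast_mem _ n
    have hHb' := harmonic_mem (p := p) hdf
    have hHd' := harmonic_mem (p := p) (show d < p by omega)
    have hHf' := harmonic_mem (p := p) (show f < p by omega)
    have ha' : a ∈ (Rat.padicValuation p).integer := mul_mem (hO _) hHb'
    have hc' : c ∈ (Rat.padicValuation p).integer := mul_mem (hO _) hHd'
    have hg' : g ∈ (Rat.padicValuation p).integer := mul_mem (hO _) hHf'
    have hWM' : WM ∈ (Rat.padicValuation p).integer := hO _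
    have hWe' : We ∈ (Rat.padicValuation p).integer := hO _
    have hs' : (s : ℚ) ∈ (Rat.padicValuation p).integer := intCast_mem s
    rw [hGdef]
    repeat' (first
      | exact hEb | exact hEd | exact hEf | exact ha' | exact hc' | exact hg' | exact hWM' | exact hWe' | exact hs'
      | exact hHb' | exact hHd' | exact hHf' | exact one_mem _ | exact hO _
      | apply add_mem | apply sub_mem | apply mul_mem)
  -- units
  have hWM0 : ¬ p ∣ blockW p M := (Nat.Prime.coprime_iff_not_dvd hp).1 (coprime_blockW hp M)
  have hWe0 : ¬ p ∣ blockW p e := (Nat.Prime.coprime_iff_not_dvd hp).1 (coprime_blockW hp e)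
  have hvWM : Rat.padicValuation p WM = 1 := padicValuation_natCast_eq_one hWM0
  have hvWe : Rat.padicValuation p We = 1 := padicValuation_natCast_eq_one hWe0
  have hvd : Rat.padicValuation p ((d ! : ℕ) : ℚ) = 1 :=
    padicValuation_natCast_eq_one (by rw [hp.dvd_factorial]; omega)
  have hvf : Rat.padicValuation p ((f ! : ℕ) : ℚ) = 1 :=
    padicValuation_natCast_eq_one (by rw [hp.dvd_factorial]; omega)
  have hWM1 : WM ≠ 0 := fun h => by rw [h, map_zero] at hvWM; exact zero_ne_one hvWM
  have hWe1 : We ≠ 0 := fun h => by rw [h, map_zero] at hvWe; exact zero_ne_one hvWe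
  have hd1 : ((d ! : ℕ) : ℚ) ≠ 0 := by positivity
  have hf1 : ((f ! : ℕ) : ℚ) ≠ 0 := by positivity
  -- the two denominators `u = 1 + MpH_d + p²E_d`, `v = 1 + epH_f + p²E_f` are `≡ 1 (mod p)`
  have hsmall : ∀ {x : ℚ}, x ∈ (Rat.padicValuation p).integer → Rat.padicValuation p ((p : ℚ) * x) < 1 := by
    intro x hx
    rw [map_mul, Rat.padicValuation_self]
    calc exp (-1) * Rat.padicValuation p x ≤ exp (-1) * 1 := by gcongr; exact hx
      _ < 1 := by rw [mul_one, ← exp_zero, exp_lt_exp]; norm_num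
  have hu : Rat.padicValuation p (1 + (M : ℚ) * p * Hd + (p : ℚ) ^ 2 * Ed) = 1 := by
    rw [show (1 + (M : ℚ) * p * Hd + (p : ℚ) ^ 2 * Ed) = 1 + (p : ℚ) * ((M : ℚ) * Hd + p * Ed) by ring]
    exact Valuation.map_one_add_of_lt _ (hsmall (add_mem (mul_mem (natCast_mem _ M) (harmonic_mem (by omega)))
      (mul_mem (natCast_mem _ p) hEd)))
  have hv : Rat.padicValuation p (1 + (e : ℚ) * p * Hf + (p : ℚ) ^ 2 * Ef) = 1 := by
    rw [show (1 + (e : ℚ) * p * Hf + (p : ℚ) ^ 2 * Ef) = 1 + (p : ℚ) * ((e : ℚ) * Hf + p * Ef) by ring]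
    exact Valuation.map_one_add_of_lt _ (hsmall (add_mem (mul_mem (natCast_mem _ e) (harmonic_mem (by omega)))
      (mul_mem (natCast_mem _ p) hEf)))
  have hu1 : (1 + (M : ℚ) * p * Hd + (p : ℚ) ^ 2 * Ed) ≠ 0 := fun h => by rw [h, map_zero] at hu; exact zero_ne_one hu
  have hv1 : (1 + (e : ℚ) * p * Hf + (p : ℚ) ^ 2 * Ef) ≠ 0 := fun h => by rw [h, map_zero] at hv; exact zero_ne_one hv
  -- the algebra: `Cbig − C(1+pα) = C·p²·G / (W_M W_e u v)`
  have hden : WM * We * ((1 + (M : ℚ) * p * Hd + (p : ℚ) ^ 2 * Ed) * (1 + (e : ℚ) * p * Hf + (p : ℚ) ^ 2 * Ef)) ≠ 0 :=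
    mul_ne_zero (mul_ne_zero hWM1 hWe1) (mul_ne_zero hu1 hv1)
  have hval : Cbig - Cnm * Cbd * (1 + (p : ℚ) * (((M + e : ℕ) : ℚ) * Hb - (M : ℚ) * Hd - (e : ℚ) * Hf)) =
      (Cnm * Cbd) * ((p : ℚ) ^ 2 * G /
        (WM * We * ((1 + (M : ℚ) * p * Hd + (p : ℚ) ^ 2 * Ed) * (1 + (e : ℚ) * p * Hf + (p : ℚ) ^ 2 * Ef)))) := by
    rw [← mul_div_assoc, eq_div_iff hden]
    apply mul_right_cancel₀ (mul_ne_zero hd1 hf1)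
    rw [ha, hc, hg] at hG'
    linear_combination key - (Cnm * (WM * We + (p : ℚ) ^ 3 * s) * (1 + ((M + e : ℕ) : ℚ) * p * Hb + (p : ℚ) ^ 2 * Eb)) * hb
      + (Cnm * Cbd * ((d ! : ℕ) : ℚ) * ((f ! : ℕ) : ℚ)) * hG'
  -- valuations
  have hG1 : Rat.padicValuation p G ≤ 1 := hGmem
  have hrest : Rat.padicValuation p ((p : ℚ) ^ 2 * G /
      (WM * We * ((1 + (M : ℚ) * p * Hd + (p : ℚ) ^ 2 * Ed) * (1 + (e : ℚ) * p * Hf + (p : ℚ) ^ 2 * Ef)))) ≤ exp (-2) := by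
    simp only [map_div₀, map_mul, map_pow, Rat.padicValuation_self, hvWM, hvWe, hu, hv, mul_one, div_one]
    rw [← exp_nsmul]
    calc exp (2 • (-1 : ℤ)) * Rat.padicValuation p G ≤ exp (2 • (-1 : ℤ)) * 1 := by gcongr
      _ = exp (-2) := by rw [mul_one]; norm_num
  rw [hval, Valuation.map_mul]
  calc Rat.padicValuation p (Cnm * Cbd) * Rat.padicValuation p ((p : ℚ) ^ 2 * G /
        (WM * We * ((1 + (M : ℚ) * p * Hd + (p : ℚ) ^ 2 * Ed) * (1 + (e : ℚ) * p * Hf + (p : ℚ) ^ 2 * Ef))))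
      ≤ Rat.padicValuation p (Cnm * Cbd) * exp (-2) := by gcongr
    _ = exp (-2) * Rat.padicValuation p (Cnm * Cbd) := mul_comm _ _

end Summit.KontsevichZagierPeriods.Zeta5Search.BlockRatioModSq
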